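import Summits.QuantumFields.BalabanUV.T4Continuum.Support.StarCarrierComponents
import Summits.QuantumFields.BalabanUV.T4Continuum.Support.RegionGaugeResolventSplit
import Summits.QuantumFields.BalabanUV.Beta.GAN24.DirichletBoxPairing

/-!
# T⁴ programme, spine node NE2 (U1a), sub-row Δ1 «NE2⁰-Dirichlet» — THE FIRST-ORDER TWO-LEVEL IDENTITY FOR THE ELECTRIC OPERATOR
# WITH KING's COMPRESSED PLANTING ON A COORDINATE BOX (file P4b of (P-gaffney)): `⟨v, (J·W − W′·J)u⟩ =
# Σ_ν [ Σ_{μ≠ν} ⟨(A_μ − F_μ)z′_ν, ∂_μ z_ν⟩ + ⟨(A_ν − F_ν)z′_ν, χ_ν·∂_ν z_ν⟩ ]` — NO Dirichlet wall term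

NE2 formalisation swarm `b2b-balaban-t4-ne2-formalise-*`, LEAF PROVER 01 (gen 10), supplier file for leaf-03-g8's item «W3-GAFFNEY-PAIRING»
= (P-gaffney) for the LOCAL operator (owner rulings R35 (c) / R36 (c); leaf-03-g8's file plan `CLAIMS.log` 2026-08-20 l.22258 and
assignment «TAKE P4» l.22541; my CLAIM l.22586).  File P4a (`Support/StarCarrierComponents`) read the star-bond objects component by
component; THIS FILE proves the identity leaf-03-g8's P3/P5 consume:

 * §0 the «no wall term» facts: **`Pdir_zext_apply_of_not_of_par`** (product region: at a fine site outside the fine carrier whose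
   parent is inside the coarse one the transverse neighbours are outside too) and **`Lam_zext_mul_JK0_zext_eq_zero`** (both directions:
   wherever the planted `J₀ z_ν` leaks out of the fine carrier, the fine directional operator of `z′_ν` vanishes).
 * §1 the two SCALAR torus identities at two levels `N`, `R·N` (any `z`, `z′`): **`transverse_pair`** — gan24-p2-g22's Dirichlet pairing
   in first-order form, `⟨J₀ᴴz′, P_μ z⟩ − ⟨P′_μ z′, J₀ z⟩ = ⟨(A_μ − F_μ)z′, ∂_μ z⟩` (`DirichletBoxPairing.Aop`/`Fop`/`Fop_conjTranspose_mul_sdiff`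
   BY NAME); **`masked_pair`** (NEW) — the NEUMANN own-direction version with the bond masks `χ_ν` (coarse) and `χ′_ν` (fine),
   `⟨J₀ᴴz′, ∂_νᴴχ∂_ν z⟩ − ⟨∂′_νᴴχ′∂′_ν z′, J₀ z⟩ = ⟨(A_ν − F_ν)z′, χ_ν·∂_ν z⟩`: King's `A_ν`, `F_ν` UNCHANGED, only the coarse
   difference is masked — on the far `ν`-faces (the only sites `F_ν` reads) the fine mask is the parent's, **`chi_fine_of_face`**.
 * §2 **`first_order_identity (hS : IsCoordBox M S) (hN : 2 ≤ N) (u) (v)`**: for `W_n = regionDeltaLoc n M 0 S` (the owner's local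
   operator at zero mass = leaf-02-g8's `Σ_μ Wdir μ`, `regionDeltaLoc_zero_eq`) and `J = JKs N R M S` (King's vector planting compressed
   to the star bonds), `star v ⬝ᵥ ((J·W_N − W_{RN}·J) u) = Σ_ν [ Σ_{μ ∈ univ.erase ν} star ((A_μ − F_μ) z′_ν) ⬝ᵥ (∂_μ z_ν)
   + star ((A_ν − F_ν) z′_ν) ⬝ᵥ (χ_ν · ∂_ν z_ν) ]`, `z_ν = zext N M S ν u`, `z′_ν = zext (R·N) M S ν v`; and **`first_order_identity_lev`**
   — the same along the tower (`N = lev L k ≥ 2`, `R = L`, `JpR L M (starP L M S) k = JKs …` by `rfl`).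
   MECHANISM: `⟨v, JWu⟩ − ⟨v, W′Ju⟩ = ⟨Jᴴv, Wu⟩ − ⟨W′v, Ju⟩` (`W′` Hermitian), `W = Σ_μ W_μ`, each dot product split over components
   (`star_dotProduct_eq_sum_zext`), the components of `W_μ u`, `Ju`, `Jᴴv` read by P4a (`Wdir_mulVec_apply_eq_Lam`, `JKs_mulVec_apply`,
   `zext_JKs_conjTranspose_mulVec`), the sums over the carriers extended to the whole torus by the vanishing facts (P4a's
   `JK0_conjTranspose_zext_apply_of_not` and §0) — **`pair_component`** —, then §1 per `(μ, ν)`.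
 * §3 THE JUNCTION TO leaf-03-g8's MASK: on `AtMostOneNeighbour` regions `χ_ν = 𝟙[T_ν ∧ T_ν(· + e_ν)]` POINTWISE
   (**`chi_eq_ite_starSite`**, via leaf-02-g8's `not_star_add_iff`), hence **`first_order_identity_ite`** / **`first_order_identity_lev_ite`**:
   the own-direction factor is literally P3's `bmask N M S ν z_ν` (unfold), the transverse factors P2's `∂_μ z_ν`.

HONEST FRAMING (T4-DAG p. 1).  [folklore] finite lattice bookkeeping on the tree's typed objects, an IDENTITY (no estimate); nothing printed
is a hypothesis or a conclusion; no NE2 statement is proved here (input of (P-gaffney) ⊂ leaf (L) of the owner's `hinjK_of_local` /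
`RegionLocalInjectedAssembly`); (P-gaffney) / (L) / `hinjK` / W3 on boxes OPEN; NE2 (U1a) NOT proved; spine PROVED 0/9 unchanged; NOT [B9]
(3.16)/(3.23)–(3.27) as printed; NOT infinite volume, NOT a mass gap, NOT the Clay problem.  HONEST DEPENDENCY: continuum YM on T⁴ ⇐
BetaPertH ∧ nine spine estimates (0/9 proved); BetaPertH ⇐ (D1) ∧ (D4) ∧ CAP+tail; G-an2-4 gates asym, D1 and NE2/3/4.  No `sorry`.
-/

noncomputable section

open scoped BigOperators ComplexConjugate Matrix Matrix.Norms.L2Operator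
open Finset

namespace Summit.QuantumFields.BalabanUV.T4Continuum.StarCarrierTwoLevelIdentity

open Literature.MathematicalPhysics.QuantumFieldTheory.Balaban1983to89.B5Prop11Plancherel (Tor fine unitVec)
open Literature.MathematicalPhysics.QuantumFieldTheory.Balaban1983to89.B5Action121 (sdiff sdiff_mulVec star_mulVec_dotProduct
  dotProduct_mulVec_eq_star_conjTranspose_mulVec)
open Literature.MathematicalPhysics.QuantumFieldTheory.Balaban1983to89.B5G183RateUnitTower (lev)
open Summit.QuantumFields.BalabanUV.T4Continuum
open Summit.QuantumFields.BalabanUV.T4Continuum.BalabanAveragedTowerModes (par)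
open Summit.QuantumFields.BalabanUV.T4Continuum.BlockPairingGeometry (par_add_unitVec)
open Summit.QuantumFields.BalabanUV.T4Continuum.ScalarBlockPlanting (Qavg0 JK0 star_Qavg0_apply)
open Summit.QuantumFields.BalabanUV.T4Continuum.ScalarPlantingDefect (blockOf_par)
open Literature.MathematicalPhysics.QuantumFieldTheory.Balaban1983to89.B5Blocks16 (blockOf)
open Summit.QuantumFields.BalabanUV.T4Continuum.ScalarPlantingFaces (faceF0 sdiff_mul_JK0)
open Summit.QuantumFields.BalabanUV.T4Continuum.DirichletSubregionTowerOf (pidx JpR)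
open Summit.QuantumFields.BalabanUV.T4Continuum.RegionGaugeFixedVector (starReg)
open Summit.QuantumFields.BalabanUV.T4Continuum.DirichletStarVectorTower (starP)
open Summit.QuantumFields.BalabanUV.T4Continuum.RegionStarBoundaryCharges (AtMostOneNeighbour atMostOneNeighbour_of_isCoordBox
  blockOf_add_unitVec_apply_of_ne blockOf_sub_unitVec_apply_of_ne)
open Summit.QuantumFields.BalabanUV.T4Continuum.RegionElectricSplitting (Wdir electric_splitting_box not_star_add_iff)
open Summit.QuantumFields.BalabanUV.T4Continuum.AlignedCarrierTrace (starSite)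
open Summit.QuantumFields.BalabanUV.T4Continuum.RegionGaugeResolventSplit (regionDeltaLoc regionDeltaLoc_eq regionDeltaLoc_isHermitian)
open Summit.QuantumFields.BalabanUV.T4Continuum.StarCarrierComponents
open Summit.QuantumFields.BalabanUV.Beta.GAN24.DirichletBoxTrace (blockReg)
open Summit.QuantumFields.BalabanUV.Beta.GAN24.DirichletBoxRegularity (Pdir Pdir_mulVec)
open Summit.QuantumFields.BalabanUV.Beta.GAN24.DirichletBoxTwoLevel (IsCoordBox)
open Summit.QuantumFields.BalabanUV.Beta.GAN24.DirichletBoxTwoLevelCore (refineR_blockReg_iff)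
open Summit.QuantumFields.BalabanUV.Beta.GAN24.DirichletBoxPairing (Aop Fop Fop_conjTranspose_mul_sdiff faceF0_conjTranspose)

variable {d : ℕ} (N R : ℕ) [NeZero N] [NeZero R] (M : Fin d → ℕ) [hM : ∀ μ, NeZero (M μ)] (S : Tor M → Prop) [DecidablePred S]

/-! ## §0 Vanishing 2 (transverse, product region): the fine directional operators vanish where the planting leaks out -/

omit [DecidablePred S] in
/-- on a product region the transverse neighbours of a fine site outside the carrier whose parent is inside stay outside the carrier
(the only missing coordinate is the own one). [folklore] -/
theorem not_star_transverse_of_par (hS : IsCoordBox M S) {μ ν : Fin d} (hμν : μ ≠ ν) {x' : Tor (fine (R * N) M)}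
    (hx : ¬ starReg (R * N) M S (x', ν)) (hpar : starReg N M S (par N R M x', ν)) :
    ¬ starReg (R * N) M S (x' + unitVec (fine (R * N) M) μ, ν) ∧ ¬ starReg (R * N) M S (x' - unitVec (fine (R * N) M) μ, ν) := by
  obtain ⟨S₀, hS₀⟩ := hS
  -- block coordinates: `Ω`-membership is coordinatewise
  have mem : ∀ (m : ℕ) [NeZero m] (w : Tor (fine m M)), blockReg m M S w ↔ ∀ l, blockOf m M w l ∈ S₀ l :=
    fun m _ w => hS₀ _
  -- the transverse coordinates of `x′` are all «in»: from the parent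
  have hparT : ∀ l, l ≠ ν → blockOf (R * N) M x' l ∈ S₀ l := by
    intro l hl
    rw [← blockOf_par N R M x']
    rcases hpar with h1 | h2
    · exact (mem _ _).mp h1 l
    · have := (mem _ _).mp h2 l
      simp only at this
      rwa [blockOf_add_unitVec_apply_of_ne N M _ hl] at this
  -- `x′ ∉ T′`: its own coordinate fails on both clauses
  have hown1 : blockOf (R * N) M x' ν ∉ S₀ ν := by
    intro hν
    apply hx
    left
    show blockReg (R * N) M S x'
    refine (mem _ x').mpr fun l => ?_
    by_cases hl : l = ν
    · rw [hl]; exact hν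
    · exact hparT l hl
  have hown2 : blockOf (R * N) M (x' + unitVec (fine (R * N) M) ν) ν ∉ S₀ ν := by
    intro hν
    apply hx
    right
    show blockReg (R * N) M S (x' + unitVec (fine (R * N) M) ν)
    refine (mem _ _).mpr fun l => ?_
    by_cases hl : l = ν
    · rw [hl]; exact hν
    · rw [blockOf_add_unitVec_apply_of_ne (R * N) M _ hl]; exact hparT l hl
  -- a transverse step does not change the own block coordinate (of `x′` or of `x′ + e_ν`)
  set e := unitVec (fine (R * N) M) μ with he
  constructor
  · rintro (h1 | h2)
    · have h1' : blockReg (R * N) M S (x' + e) := h1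
      have := (mem _ _).mp h1' ν
      rw [he, blockOf_add_unitVec_apply_of_ne (R * N) M _ hμν.symm] at this
      exact hown1 this
    · have h2' : blockReg (R * N) M S (x' + e + unitVec (fine (R * N) M) ν) := h2
      rw [add_right_comm] at h2'
      have := (mem _ _).mp h2' ν
      rw [he, blockOf_add_unitVec_apply_of_ne (R * N) M _ hμν.symm] at this
      exact hown2 this
  · rintro (h1 | h2)
    · have h1' : blockReg (R * N) M S (x' - e) := h1
      have := (mem _ _).mp h1' ν
      rw [he, blockOf_sub_unitVec_apply_of_ne (R * N) M _ hμν.symm] at this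
      exact hown1 this
    · have h2' : blockReg (R * N) M S (x' - e + unitVec (fine (R * N) M) ν) := h2
      rw [sub_add_eq_add_sub] at h2'
      have := (mem _ _).mp h2' ν
      rw [he, blockOf_sub_unitVec_apply_of_ne (R * N) M _ hμν.symm] at this
      exact hown2 this

/-- **VANISHING 2 (transverse, product region)**: at a fine site outside the fine carrier whose parent is inside the coarse carrier,
`(P′_μ z′_ν)(x′) = 0` for `μ ≠ ν`. [folklore] -/
theorem Pdir_zext_apply_of_not_of_par (hS : IsCoordBox M S) {μ ν : Fin d} (hμν : μ ≠ ν) (v : {b // starReg (R * N) M S b} → ℂ)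
    {x' : Tor (fine (R * N) M)} (hx : ¬ starReg (R * N) M S (x', ν)) (hpar : starReg N M S (par N R M x', ν)) :
    (Pdir (fine (R * N) M) ((R * N : ℕ) : ℂ) μ *ᵥ zext (R * N) M S ν v) x' = 0 := by
  obtain ⟨hp, hm⟩ := not_star_transverse_of_par N R M S hS hμν hx hpar
  rw [Pdir_mulVec, zext_apply_of_not _ M S ν v hx, zext_apply_of_not _ M S ν v hp, zext_apply_of_not _ M S ν v hm]
  ring

/-- **VANISHING 2, both directions, as used**: `conj((Λ′^{μ,ν} z′_ν)(x′))·(J₀ z_ν)(x′) = 0` off the fine carrier (own direction: the masked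
operator vanishes there outright; transverse: the planting vanishes unless the parent is a star bond, and then the operator vanishes).
[folklore] -/
theorem Lam_zext_mul_JK0_zext_eq_zero (hS : IsCoordBox M S) (μ ν : Fin d) (u : {b // starReg N M S b} → ℂ)
    (v : {b // starReg (R * N) M S b} → ℂ) {x' : Tor (fine (R * N) M)} (hx : ¬ starReg (R * N) M S (x', ν)) :
    star ((Lam (R * N) M S μ ν *ᵥ zext (R * N) M S ν v) x') * (JK0 N R M *ᵥ zext N M S ν u) x' = 0 := by
  unfold Lam
  by_cases hμν : μ = ν
  · subst hμν
    rw [if_pos rfl, Pneu_zext_apply_of_not _ M S μ v hx, star_zero, zero_mul]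
  · rw [if_neg hμν]
    by_cases hpar : starReg N M S (par N R M x', ν)
    · rw [Pdir_zext_apply_of_not_of_par N R M S hS hμν v hx hpar, star_zero, zero_mul]
    · -- the planting vanishes: `(J₀ z_ν)(x′) = c·z_ν(par x′) = 0`
      have h0 : (JK0 N R M *ᵥ zext N M S ν u) x' = 0 := by
        simp only [Matrix.mulVec, dotProduct]
        refine sum_eq_zero fun y _ => ?_
        by_cases hy : par N R M x' = y
        · rw [← hy, zext_apply_of_not _ M S ν u hpar, mul_zero]
        · rw [JK0, Matrix.smul_apply, Matrix.conjTranspose_apply, star_Qavg0_apply]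
          unfold Qavg0
          rw [if_neg hy, smul_zero, zero_mul]
      rw [h0, mul_zero]

omit [DecidablePred S] in

/-! ## §1 The two scalar torus identities: Dirichlet (King / gan24) and masked Neumann (new) -/

/-- `P_μ` is Hermitian. [folklore] -/
theorem Pdir_conjTranspose (n : ℕ) [NeZero n] (μ : Fin d) : (Pdir (fine n M) (n : ℂ) μ)ᴴ = Pdir (fine n M) (n : ℂ) μ := by
  rw [Pdir, Matrix.conjTranspose_mul, Matrix.conjTranspose_conjTranspose]

/-- **THE DIRICHLET (TRANSVERSE) TWO-LEVEL IDENTITY, first-order form** (gan24-p2-g22's `pairing_identity`, one direction, read with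
the planting on either side): `⟨J₀ᴴz′, P_μ z⟩ − ⟨P′_μ z′, J₀ z⟩ = ⟨(A_μ − F_μ) z′, ∂_μ z⟩`. [folklore] -/
theorem transverse_pair (hN : 1 ≤ N) (μ : Fin d) (z : Tor (fine N M) → ℂ) (z' : Tor (fine (R * N) M) → ℂ) :
    star ((JK0 N R M)ᴴ *ᵥ z') ⬝ᵥ (Pdir (fine N M) (N : ℂ) μ *ᵥ z)
        - star (Pdir (fine (R * N) M) ((R * N : ℕ) : ℂ) μ *ᵥ z') ⬝ᵥ (JK0 N R M *ᵥ z)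
      = star ((Aop N R M μ - Fop N R M μ) *ᵥ z') ⬝ᵥ (sdiff (fine N M) (N : ℂ) μ *ᵥ z) := by
  have hA : (Aop N R M μ)ᴴ *ᵥ (sdiff (fine N M) (N : ℂ) μ *ᵥ z) = JK0 N R M *ᵥ (Pdir (fine N M) (N : ℂ) μ *ᵥ z) := by
    rw [Aop, Matrix.conjTranspose_mul, Matrix.conjTranspose_conjTranspose, Matrix.mulVec_mulVec, Matrix.mulVec_mulVec, Pdir,
      Matrix.mul_assoc]
  have hF : (Fop N R M μ)ᴴ *ᵥ (sdiff (fine N M) (N : ℂ) μ *ᵥ z) = Pdir (fine (R * N) M) ((R * N : ℕ) : ℂ) μ *ᵥ (JK0 N R M *ᵥ z) := by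
    rw [Matrix.mulVec_mulVec, Fop_conjTranspose_mul_sdiff N R M hN μ, Matrix.mulVec_mulVec, Pdir]
  rw [star_mulVec_dotProduct (Aop N R M μ - Fop N R M μ), Matrix.conjTranspose_sub, Matrix.sub_mulVec, dotProduct_sub, hA, hF,
    star_mulVec_dotProduct ((JK0 N R M)ᴴ), Matrix.conjTranspose_conjTranspose,
    star_mulVec_dotProduct (Pdir (fine (R * N) M) ((R * N : ℕ) : ℂ) μ), Pdir_conjTranspose]

omit [NeZero R] in
/-- King's scalar planting, entrywise: `(J₀ ψ)(x′) = √(R^d)·R^{−d}·ψ(par x′)`. [folklore] -/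
theorem JK0_mulVec_apply (ψ : Tor (fine N M) → ℂ) (x' : Tor (fine (R * N) M)) :
    (JK0 N R M *ᵥ ψ) x' = (((Real.sqrt ((R : ℝ) ^ d)) : ℝ) : ℂ) * ((((R : ℂ) ^ d))⁻¹ * ψ (par N R M x')) := by
  simp only [Matrix.mulVec, dotProduct, JK0, Matrix.smul_apply, Matrix.conjTranspose_apply, star_Qavg0_apply, smul_eq_mul]
  simp only [Qavg0, mul_ite, mul_zero, ite_mul, zero_mul]
  rw [Finset.sum_ite_eq Finset.univ (par N R M x'), if_pos (Finset.mem_univ _), mul_assoc]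

/-- **FAR-FACE CHILDREN INHERIT THE PARENT'S MASK**: on the far `ν`-face of a block (`R ∣ x′_ν + 1`) the fine Neumann mask is the coarse one
of the parent, `χ′_ν(x′) = χ_ν(par x′)` (`par(x′ + e′_ν) = par x′ + e_ν` there). [folklore] -/
theorem chi_fine_of_face {ν : Fin d} {x' : Tor (fine (R * N) M)} (hf : R ∣ (x' ν).val + 1) :
    chi (R * N) M S ν x' = chi N M S ν (par N R M x') := by
  unfold chi
  have hpar : par N R M (x' + unitVec (fine (R * N) M) ν) = par N R M x' + unitVec (fine N M) ν := by
    rw [par_add_unitVec, if_pos hf]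
  have hiff : blockReg (R * N) M S (x' + unitVec (fine (R * N) M) ν) ↔ blockReg N M S (par N R M x' + unitVec (fine N M) ν) := by
    rw [← refineR_blockReg_iff N R M S, ← hpar]; rfl
  by_cases h : blockReg N M S (par N R M x' + unitVec (fine N M) ν)
  · rw [if_pos (hiff.mpr h), if_pos h]
  · rw [if_neg (fun h' => h (hiff.mp h')), if_neg h]

omit [NeZero R] in
/-- the mask is real (`0` or `1`): `conj χ = χ`. [folklore] -/
theorem star_chi (n : ℕ) [NeZero n] (ν : Fin d) (y : Tor (fine n M)) : star (chi n M S ν y) = chi n M S ν y := by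
  unfold chi; split_ifs <;> simp

/-- **THE MASKED (NEUMANN, OWN-DIRECTION) TWO-LEVEL IDENTITY, first-order form** (new): with the Neumann masks `χ` (coarse), `χ′` (fine),
`⟨J₀ᴴz′, ∂ᴴχ∂ z⟩ − ⟨∂′ᴴχ′∂′ z′, J₀ z⟩ = ⟨(A_ν − F_ν) z′, χ·∂_ν z⟩` — King's `A_ν`/`F_ν` UNCHANGED (far faces: `chi_fine_of_face`). [folklore] -/
theorem masked_pair (hN : 1 ≤ N) (ν : Fin d) (z : Tor (fine N M) → ℂ) (z' : Tor (fine (R * N) M) → ℂ) :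
    star ((JK0 N R M)ᴴ *ᵥ z') ⬝ᵥ (Pneu N M S ν *ᵥ z) - star (Pneu (R * N) M S ν *ᵥ z') ⬝ᵥ (JK0 N R M *ᵥ z)
      = star ((Aop N R M ν - Fop N R M ν) *ᵥ z') ⬝ᵥ (fun y => chi N M S ν y * (sdiff (fine N M) (N : ℂ) ν *ᵥ z) y) := by
  set m : Tor (fine N M) → ℂ := fun y => chi N M S ν y * (sdiff (fine N M) (N : ℂ) ν *ᵥ z) y with hmdef
  have hm : Matrix.diagonal (chi N M S ν) *ᵥ (sdiff (fine N M) (N : ℂ) ν *ᵥ z) = m := by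
    funext y; rw [Matrix.mulVec_diagonal]
  -- the `A` halves agree outright
  have hA : star ((JK0 N R M)ᴴ *ᵥ z') ⬝ᵥ (Pneu N M S ν *ᵥ z) = star ((Aop N R M ν) *ᵥ z') ⬝ᵥ m := by
    rw [star_mulVec_dotProduct ((JK0 N R M)ᴴ), Matrix.conjTranspose_conjTranspose, star_mulVec_dotProduct (Aop N R M ν), Aop,
      Matrix.conjTranspose_mul, Matrix.conjTranspose_conjTranspose, Pneu, ← Matrix.mulVec_mulVec, ← Matrix.mulVec_mulVec, hm,
      ← Matrix.mulVec_mulVec]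
  -- the `F` halves: both are `R·Σ_{x′} conj(∂′z′)(x′)·F⁰(x′)·(…)(x′)`, and on the far faces `χ′ = χ ∘ par`
  have hR : star (R : ℂ) = (R : ℂ) := Complex.conj_natCast R
  have hF : star (Pneu (R * N) M S ν *ᵥ z') ⬝ᵥ (JK0 N R M *ᵥ z) = star ((Fop N R M ν) *ᵥ z') ⬝ᵥ m := by
    set w : Tor (fine (R * N) M) → ℂ := Matrix.diagonal (chi (R * N) M S ν) *ᵥ (sdiff (fine (R * N) M) ((R * N : ℕ) : ℂ) ν *ᵥ z')
      with hwdef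
    have e1 : Pneu (R * N) M S ν *ᵥ z' = (sdiff (fine (R * N) M) ((R * N : ℕ) : ℂ) ν)ᴴ *ᵥ w := by
      rw [hwdef, Pneu, ← Matrix.mulVec_mulVec, ← Matrix.mulVec_mulVec]
    have e2 : sdiff (fine (R * N) M) ((R * N : ℕ) : ℂ) ν *ᵥ (JK0 N R M *ᵥ z)
        = (R : ℂ) • (faceF0 N R M ν *ᵥ (JK0 N R M *ᵥ (sdiff (fine N M) (N : ℂ) ν *ᵥ z))) := by
      rw [Matrix.mulVec_mulVec, sdiff_mul_JK0 N R M hN ν, Matrix.smul_mulVec, ← Matrix.mulVec_mulVec, ← Matrix.mulVec_mulVec]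
    have e3 : (Fop N R M ν)ᴴ *ᵥ m = (R : ℂ) • ((sdiff (fine (R * N) M) ((R * N : ℕ) : ℂ) ν)ᴴ *ᵥ (faceF0 N R M ν *ᵥ (JK0 N R M *ᵥ m))) := by
      rw [Fop, Matrix.conjTranspose_smul, Matrix.conjTranspose_mul, Matrix.conjTranspose_mul, Matrix.conjTranspose_conjTranspose,
        faceF0_conjTranspose, hR, Matrix.smul_mulVec, ← Matrix.mulVec_mulVec, ← Matrix.mulVec_mulVec]
    rw [e1, star_mulVec_dotProduct ((sdiff (fine (R * N) M) ((R * N : ℕ) : ℂ) ν)ᴴ), Matrix.conjTranspose_conjTranspose, e2,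
      dotProduct_smul, star_mulVec_dotProduct (Fop N R M ν), e3, dotProduct_smul,
      dotProduct_mulVec_eq_star_conjTranspose_mulVec ((sdiff (fine (R * N) M) ((R * N : ℕ) : ℂ) ν)ᴴ), Matrix.conjTranspose_conjTranspose]
    congr 1
    -- pointwise on the fine torus
    unfold dotProduct
    refine Finset.sum_congr rfl fun x' _ => ?_
    rw [hwdef, Pi.star_apply, Pi.star_apply, Matrix.mulVec_diagonal, faceF0, Matrix.mulVec_diagonal, Matrix.mulVec_diagonal,
      JK0_mulVec_apply, JK0_mulVec_apply, hmdef]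
    by_cases hf : R ∣ (x' ν).val + 1
    · rw [if_pos hf, chi_fine_of_face N R M S hf, star_mul', star_chi]
      ring
    · rw [if_neg hf]; ring
  rw [hA, hF, Matrix.sub_mulVec, star_sub, sub_dotProduct]

/-! ## §2 The first-order identity for the electric operator with King's compressed planting -/

/-- `regionDeltaLoc` at zero mass on a product region is leaf-02-g8's electric splitting `Σ_μ W_μ` (the `a = 0` case of
`RegionElectricHessian.regionDeltaLoc_eq_sum_Wdir_box`, restated from `electric_splitting_box` to keep the import closure small). [folklore] -/
theorem regionDeltaLoc_zero_eq (n : ℕ) [NeZero n] (hn : 2 ≤ n) (hS : IsCoordBox M S) :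
    regionDeltaLoc n M 0 S = ∑ μ, Wdir n M S μ := by
  rw [regionDeltaLoc_eq, electric_splitting_box n M S hn hS, zero_mul, Complex.ofReal_zero, zero_smul, add_zero]

/-- the per-direction, per-component commutator term in scalar form. [folklore] -/
theorem pair_component (hS : IsCoordBox M S) (hN : 2 ≤ N) (μ ν : Fin d) (u : {b // starReg N M S b} → ℂ)
    (v : {b // starReg (R * N) M S b} → ℂ) :
    star (zext N M S ν ((JKs N R M S)ᴴ *ᵥ v)) ⬝ᵥ zext N M S ν (Wdir N M S μ *ᵥ u)
        - star (zext (R * N) M S ν (Wdir (R * N) M S μ *ᵥ v)) ⬝ᵥ zext (R * N) M S ν (JKs N R M S *ᵥ u)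
      = star ((JK0 N R M)ᴴ *ᵥ zext (R * N) M S ν v) ⬝ᵥ (Lam N M S μ ν *ᵥ zext N M S ν u)
        - star (Lam (R * N) M S μ ν *ᵥ zext (R * N) M S ν v) ⬝ᵥ (JK0 N R M *ᵥ zext N M S ν u) := by
  have hR1 : 1 ≤ R := Nat.pos_of_ne_zero (NeZero.ne R)
  have hRN : 2 ≤ R * N := le_trans hN (Nat.le_mul_of_pos_left N hR1)
  have hH : AtMostOneNeighbour N M S := atMostOneNeighbour_of_isCoordBox N M S hN hS
  have hH' : AtMostOneNeighbour (R * N) M S := atMostOneNeighbour_of_isCoordBox (R * N) M S hRN hS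
  congr 1
  · rw [zext_JKs_conjTranspose_mulVec]
    unfold dotProduct
    refine Finset.sum_congr rfl fun y _ => ?_
    by_cases h : starReg N M S (y, ν)
    · rw [zext_apply_of N M S ν _ h, Wdir_mulVec_apply_eq_Lam N M S hH μ ν u h]
    · rw [zext_apply_of_not N M S ν _ h, Pi.star_apply, JK0_conjTranspose_zext_apply_of_not N R M S v h, star_zero, zero_mul,
        zero_mul]
  · unfold dotProduct
    refine Finset.sum_congr rfl fun x' _ => ?_
    by_cases h' : starReg (R * N) M S (x', ν)
    · rw [Pi.star_apply, Pi.star_apply, zext_apply_of (R * N) M S ν _ h', zext_apply_of (R * N) M S ν _ h',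
        Wdir_mulVec_apply_eq_Lam (R * N) M S hH' μ ν v h', JKs_mulVec_apply N R M S u h']
    · rw [Pi.star_apply, Pi.star_apply, zext_apply_of_not (R * N) M S ν _ h', zext_apply_of_not (R * N) M S ν _ h', star_zero,
        zero_mul, Lam_zext_mul_JK0_zext_eq_zero N R M S hS μ ν u v h']

/-- **THE FIRST-ORDER IDENTITY** (two levels `N ≥ 2`, `R·N`; `S` a coordinate box; `W_n = regionDeltaLoc n M 0 S` the electric operator;
`J = JKs` King's compressed vector planting): `⟨v, (J·W_N − W_{RN}·J)u⟩ = Σ_ν [ Σ_{μ≠ν} ⟨(A_μ − F_μ)z′_ν, ∂_μ z_ν⟩ + ⟨(A_ν − F_ν)z′_ν, χ_ν·∂_ν z_ν⟩ ]`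
with `z_ν`, `z′_ν` the zero-extended components and gan24-p2-g22's TORUS operators `A_μ`, `F_μ` unchanged — NO Dirichlet wall term.
[folklore] -/
theorem first_order_identity (hS : IsCoordBox M S) (hN : 2 ≤ N) (u : {b // starReg N M S b} → ℂ) (v : {b // starReg (R * N) M S b} → ℂ) :
    star v ⬝ᵥ ((JKs N R M S * regionDeltaLoc N M 0 S - regionDeltaLoc (R * N) M 0 S * JKs N R M S) *ᵥ u)
      = ∑ ν, ((∑ μ ∈ univ.erase ν, star ((Aop N R M μ - Fop N R M μ) *ᵥ zext (R * N) M S ν v) ⬝ᵥ (sdiff (fine N M) (N : ℂ) μ *ᵥ zext N M S ν u))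
          + star ((Aop N R M ν - Fop N R M ν) *ᵥ zext (R * N) M S ν v)
              ⬝ᵥ (fun y => chi N M S ν y * (sdiff (fine N M) (N : ℂ) ν *ᵥ zext N M S ν u) y)) := by
  have hR1 : 1 ≤ R := Nat.pos_of_ne_zero (NeZero.ne R)
  have hN1 : 1 ≤ N := le_trans (by norm_num) hN
  have hRN : 2 ≤ R * N := le_trans hN (Nat.le_mul_of_pos_left N hR1)
  rw [Matrix.sub_mulVec, dotProduct_sub, ← Matrix.mulVec_mulVec, ← Matrix.mulVec_mulVec,
    dotProduct_mulVec_eq_star_conjTranspose_mulVec (JKs N R M S),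
    dotProduct_mulVec_eq_star_conjTranspose_mulVec (regionDeltaLoc (R * N) M 0 S), (regionDeltaLoc_isHermitian (R * N) M 0 S).eq,
    regionDeltaLoc_zero_eq M S N hN hS, regionDeltaLoc_zero_eq M S (R * N) hRN hS, Matrix.sum_mulVec, Matrix.sum_mulVec, dotProduct_sum,
    star_sum, sum_dotProduct, ← Finset.sum_sub_distrib]
  -- per direction `μ`, by components `ν`
  have key : ∀ μ, star ((JKs N R M S)ᴴ *ᵥ v) ⬝ᵥ (Wdir N M S μ *ᵥ u) - star (Wdir (R * N) M S μ *ᵥ v) ⬝ᵥ (JKs N R M S *ᵥ u)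
      = ∑ ν, (star ((JK0 N R M)ᴴ *ᵥ zext (R * N) M S ν v) ⬝ᵥ (Lam N M S μ ν *ᵥ zext N M S ν u)
          - star (Lam (R * N) M S μ ν *ᵥ zext (R * N) M S ν v) ⬝ᵥ (JK0 N R M *ᵥ zext N M S ν u)) := by
    intro μ
    rw [star_dotProduct_eq_sum_zext N M S ((JKs N R M S)ᴴ *ᵥ v) (Wdir N M S μ *ᵥ u),
      star_dotProduct_eq_sum_zext (R * N) M S (Wdir (R * N) M S μ *ᵥ v) (JKs N R M S *ᵥ u), ← Finset.sum_sub_distrib]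
    exact Finset.sum_congr rfl fun ν _ => pair_component N R M S hS hN μ ν u v
  rw [Finset.sum_congr rfl fun μ _ => key μ, Finset.sum_comm]
  refine Finset.sum_congr rfl fun ν _ => ?_
  rw [← Finset.add_sum_erase _ _ (Finset.mem_univ ν), add_comm]
  congr 1
  · refine Finset.sum_congr rfl fun μ hμ => ?_
    have hμν : μ ≠ ν := Finset.ne_of_mem_erase hμ
    simp only [Lam, if_neg hμν]
    exact transverse_pair N R M hN1 μ _ _
  · simp only [Lam, if_true]
    exact masked_pair N R M S hN1 ν _ _

/-- **THE SAME ALONG THE TOWER** (`N = lev L k ≥ 2`, `R = L`; `JpR L M (starP L M S) k = JKs (lev L k) L M S` by `rfl`) — leaf-03-g8's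
displayed shape for «W3-GAFFNEY-PAIRING» P3/P5. [folklore] -/
theorem first_order_identity_lev (L : ℕ) [NeZero L] (hS : IsCoordBox M S) (k : ℕ) (hN : 2 ≤ lev L k)
    (u : pidx L M (starP L M S) k → ℂ) (v : pidx L M (starP L M S) (k + 1) → ℂ) :
    star v ⬝ᵥ ((JpR L M (starP L M S) k * regionDeltaLoc (lev L k) M 0 S - regionDeltaLoc (lev L (k + 1)) M 0 S * JpR L M (starP L M S) k) *ᵥ u)
      = ∑ ν, ((∑ μ ∈ univ.erase ν, star ((Aop (lev L k) L M μ - Fop (lev L k) L M μ) *ᵥ zext (lev L (k + 1)) M S ν v)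
              ⬝ᵥ (sdiff (fine (lev L k) M) ((lev L k : ℕ) : ℂ) μ *ᵥ zext (lev L k) M S ν u))
          + star ((Aop (lev L k) L M ν - Fop (lev L k) L M ν) *ᵥ zext (lev L (k + 1)) M S ν v)
              ⬝ᵥ (fun y => chi (lev L k) M S ν y * (sdiff (fine (lev L k) M) ((lev L k : ℕ) : ℂ) ν *ᵥ zext (lev L k) M S ν u) y)) :=
  first_order_identity (lev L k) L M S hS hN u v


/-! ## §3 The junction to leaf-03-g8's pair mask: `χ_ν = 𝟙[T_ν ∧ T_ν(· + e_ν)]` on `AtMostOneNeighbour` regions -/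

/-- **`χ = θ` ON `AtMostOneNeighbour` REGIONS**: the Neumann bond mask `χ_ν(y) = 𝟙[y + e_ν ∈ Ω]` IS leaf-03-g8's pair mask
`𝟙[T_ν y ∧ T_ν (y + e_ν)]` (P3 `bmask`), POINTWISE (`T_ν y ∧ T_ν(y + e_ν) ∧ y + e_ν ∉ Ω` would give the exterior site `y + e_ν` the two
neighbours `y`, `y + 2e_ν` in `Ω` — leaf-02-g8's `not_star_add_iff`). [folklore] -/
theorem chi_eq_ite_starSite (hH : AtMostOneNeighbour N M S) (ν : Fin d) (y : Tor (fine N M)) :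
    chi N M S ν y = if (starSite N M S ν y ∧ starSite N M S ν (y + unitVec (fine N M) ν)) then 1 else 0 := by
  unfold chi
  by_cases h : blockReg N M S (y + unitVec (fine N M) ν)
  · rw [if_pos h, if_pos]
    exact ⟨Or.inr h, Or.inl h⟩
  · rw [if_neg h, if_neg]
    rintro ⟨hy, hy'⟩
    exact ((not_star_add_iff N M S hH ⟨(y, ν), hy⟩).mpr h) hy'

/-- the masked coarse gradient in leaf-03-g8's `bmask` spelling (`AtMostOneNeighbour`; any `z`). [folklore] -/
theorem chi_mul_sdiff_eq_ite (hH : AtMostOneNeighbour N M S) (ν : Fin d) (z : Tor (fine N M) → ℂ) :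
    (fun y => chi N M S ν y * (sdiff (fine N M) (N : ℂ) ν *ᵥ z) y)
      = fun y => if (starSite N M S ν y ∧ starSite N M S ν (y + unitVec (fine N M) ν))
          then (sdiff (fine N M) (N : ℂ) ν *ᵥ z) y else 0 := by
  funext y
  rw [chi_eq_ite_starSite N M S hH ν y]
  split_ifs <;> simp

/-- **THE FIRST-ORDER IDENTITY IN leaf-03-g8's MASK** (product region, `N ≥ 2`): the own-direction factor is P3's `bmask N M S ν z_ν`
(unfold `bmask`), the transverse factors P2's `∂_μ z_ν`; the supports `z ⊂ T`, `z′ ⊂ T′` are P4a's `zext_apply_of_not`. [folklore] -/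
theorem first_order_identity_ite (hS : IsCoordBox M S) (hN : 2 ≤ N) (u : {b // starReg N M S b} → ℂ)
    (v : {b // starReg (R * N) M S b} → ℂ) :
    star v ⬝ᵥ ((JKs N R M S * regionDeltaLoc N M 0 S - regionDeltaLoc (R * N) M 0 S * JKs N R M S) *ᵥ u)
      = ∑ ν, ((∑ μ ∈ univ.erase ν, star ((Aop N R M μ - Fop N R M μ) *ᵥ zext (R * N) M S ν v)
              ⬝ᵥ (sdiff (fine N M) (N : ℂ) μ *ᵥ zext N M S ν u))
          + star ((Aop N R M ν - Fop N R M ν) *ᵥ zext (R * N) M S ν v)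
              ⬝ᵥ (fun y => if (starSite N M S ν y ∧ starSite N M S ν (y + unitVec (fine N M) ν))
                  then (sdiff (fine N M) (N : ℂ) ν *ᵥ zext N M S ν u) y else 0)) := by
  rw [first_order_identity N R M S hS hN u v]
  refine Finset.sum_congr rfl fun ν _ => ?_
  rw [chi_mul_sdiff_eq_ite N M S (atMostOneNeighbour_of_isCoordBox N M S hN hS) ν]

/-- the same along the tower, in leaf-03-g8's mask. [folklore] -/
theorem first_order_identity_lev_ite (L : ℕ) [NeZero L] (hS : IsCoordBox M S) (k : ℕ) (hN : 2 ≤ lev L k)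
    (u : pidx L M (starP L M S) k → ℂ) (v : pidx L M (starP L M S) (k + 1) → ℂ) :
    star v ⬝ᵥ ((JpR L M (starP L M S) k * regionDeltaLoc (lev L k) M 0 S - regionDeltaLoc (lev L (k + 1)) M 0 S * JpR L M (starP L M S) k) *ᵥ u)
      = ∑ ν, ((∑ μ ∈ univ.erase ν, star ((Aop (lev L k) L M μ - Fop (lev L k) L M μ) *ᵥ zext (lev L (k + 1)) M S ν v)
              ⬝ᵥ (sdiff (fine (lev L k) M) ((lev L k : ℕ) : ℂ) μ *ᵥ zext (lev L k) M S ν u))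
          + star ((Aop (lev L k) L M ν - Fop (lev L k) L M ν) *ᵥ zext (lev L (k + 1)) M S ν v)
              ⬝ᵥ (fun y => if (starSite (lev L k) M S ν y ∧ starSite (lev L k) M S ν (y + unitVec (fine (lev L k) M) ν))
                  then (sdiff (fine (lev L k) M) ((lev L k : ℕ) : ℂ) ν *ᵥ zext (lev L k) M S ν u) y else 0)) :=
  first_order_identity_ite (lev L k) L M S hS hN u v

end Summit.QuantumFields.BalabanUV.T4Continuum.StarCarrierTwoLevelIdentity

end
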